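import Literature.AlgebraicGeometry.HodgeTheory.CyclicCoverUniversalFamily
import Literature.AlgebraicGeometry.Motives.UniversalHypersurfaceBaseChart
import HarnessLib

/-!
# The scaling line `λ ↦ x₃^p − λ f` of the Carlson–Toledo family of cyclic covers

Family `hodge`, layer `Literature/AlgebraicGeometry/HodgeTheory`; theorems and scheme-level constructions
only (no named fact). Written by the prover seat `hodge-nonav-prover-Ax` (g7) for crux K1
`VeryGeneralDeckCommutatorsInHg` of `Summits/HodgeConjecture/HodgeConjecture/Theses/CyclicUnitaryPowers.lean`
(stmt-HodgeConjecture-19544), first file of the proof that **the covering transformation of a cyclic cover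
`X_F : x₃^p = f` is a monodromy transformation of the universal family `cyclicCoverFamily p`** — the rational
transport along the scaling loop `u ↦ [x₃^p − e^{2πiu} f]` of the base `S(ℂ) = Ũ(ℂ)` (which contains the
whole `ℂ^×`-orbit of every point, Carlson–Toledo 1999 §2: "`𝐘` is defined on `ℂ^{N+1} − {0}` and has smooth
fibers over `Ũ = ℂ^{N+1} − Δ̃`") is `(σ_F^{-1})^*`: over the loop the family is `x₃^p = e^{2πiu} f`,
trivialised by `x₃ ↦ e^{2πiu/p} x₃`, whose value at `u = 1` is the deck transformation `x₃ ↦ ζ_p x₃`. This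
file sets up the ONE-PARAMETER SUB-FAMILY over the scaling line:

* §1 `isNonsingularForm_cyclicCoverForm_smul` — `x₃^p − c·f` is a nonsingular form iff `x₃^p − f` is
  (`c ≠ 0`; gradient criterion);
* §2 `scalingSpz p f : ℂ[a_m] → ℂ[λ]` — the coefficient specialisation `a_{x₃^p} ↦ 1`, `a_{(e,0)} ↦ −λ·f_e`
  (the composite of the Carlson–Toledo specialisation `cyclicCoverSpz p` with `b_e ↦ f_e λ`), surjective
  for `f ≠ 0`; the specialised family `scalingFamily p f = familySpz` over the open set `S_λ ⊆ 𝔸¹` of `λ`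
  with `x₃^p − λ f` nonsingular (`Motives/SpecialisedHypersurfaceFamily`), its points `scalingPoint`
  (`λ ≠ 0`), and the point `cyclicCoverPoint p (c • f)` of the Carlson–Toledo base with the same image
  `[x₃^p − c f]` in `U(ℂ)`;
* §3 continuity: points of a specialised base along a SURJECTIVE specialisation embed into `U(ℂ)`
  (`isEmbedding_map_toBaseSpz`), so a family of points is continuous as soon as its image in `U(ℂ)` is
  (`continuous_of_map_toBaseSpz`); the half-circles `c₁(u) = e^{πiu}`, `c₂(u) = −e^{πiu}` give paths
  `scalingArc`, `cyclicCoverArc` in `S_λ(ℂ)`, `S(ℂ)` over the SAME path `universalArc` of `U(ℂ)`.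

## References

* [CarlsonToledo1999] J. A. Carlson, D. Toledo, Discriminant complements and kernels of monodromy
  representations, Duke Math. J. 97 (1999), §2 (held text `paper:arxiv-alg-geom_9708002` p0004–p0005).
* [VoisinHodgeII2003] C. Voisin, Hodge Theory and Complex Algebraic Geometry II, CUP 2003, §3.1.2, §6.2.1.
* [SerreGAGA1956] J.-P. Serre, GAGA, Ann. Inst. Fourier 6 (1956), §2 n°5.
-/

noncomputable section

namespace Literature.AlgebraicGeometry.HodgeTheory

open CategoryTheory MvPolynomial
open _root_.Topology
open Literature.AlgebraicGeometry.Motives Literature.AlgebraicGeometry.Motives.UniversalHypersurface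
open Literature.AlgebraicGeometry.HodgeTheory.UniversalHypersurface
open Literature.AlgebraicTopology.SingularHomology

namespace CyclicCoverScaling

/-! ### §1 `x₃^p − c f` is nonsingular iff `x₃^p − f` is (`c ≠ 0`) -/

section Nonsingular

variable {p : ℕ} {f : MvPolynomial (Fin 3) ℂ}

-- adapted from Literature/AlgebraicGeometry/HodgeTheory/CyclicCoverFormNonsingular.lean (private helpers there)

/-- `(Fin.snoc x t) ∘ castSucc = x`. [folklore] -/
private theorem snoc_comp_castSucc (x : Fin 3 → ℂ) (t : ℂ) : (Fin.snoc x t : Fin 4 → ℂ) ∘ Fin.castSucc = x :=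
  funext fun i ↦ Fin.snoc_castSucc (α := fun _ ↦ ℂ) (p := x) (x := t) i

/-- `Fin.snoc x t ≠ 0` when `x ≠ 0`. [folklore] -/
private theorem snoc_ne_zero {x : Fin 3 → ℂ} (hx : x ≠ 0) (t : ℂ) : (Fin.snoc x t : Fin 4 → ℂ) ≠ 0 := by
  intro h0
  apply hx
  funext i
  have := congrFun h0 (Fin.castSucc i)
  rwa [Fin.snoc_castSucc] at this

/-- `x₃` does not occur in a form in `x₀, x₁, x₂`. [folklore] -/
private theorem last_notMem_vars_rename_castSucc (g : MvPolynomial (Fin 3) ℂ) :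
    Fin.last 3 ∉ (rename Fin.castSucc g : MvPolynomial (Fin 4) ℂ).vars := by
  classical
  intro h
  obtain ⟨i, -, hi⟩ := Finset.mem_image.1 (vars_rename Fin.castSucc g h)
  exact (Fin.castSucc_lt_last i).ne hi

/-- `F(x,t) = t^p − g(x)` for `F = x₃^p − g`. [folklore] -/
private theorem eval_snoc_cyclicCoverForm (g : MvPolynomial (Fin 3) ℂ) (x : Fin 3 → ℂ) (t : ℂ) :
    MvPolynomial.eval (Fin.snoc x t : Fin 4 → ℂ) (cyclicCoverForm p g) = t ^ p - MvPolynomial.eval x g := by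
  rw [cyclicCoverForm_def, map_sub, map_pow, MvPolynomial.eval_X, Fin.snoc_last, eval_rename, snoc_comp_castSucc]

/-- `∂F/∂x₃ (x,t) = p t^{p−1}`. [folklore] -/
private theorem eval_snoc_pderiv_last (g : MvPolynomial (Fin 3) ℂ) (x : Fin 3 → ℂ) (t : ℂ) :
    MvPolynomial.eval (Fin.snoc x t : Fin 4 → ℂ) (pderiv (Fin.last 3) (cyclicCoverForm p g)) =
      (p : ℂ) * t ^ (p - 1) := by
  rw [cyclicCoverForm_def, map_sub, pderiv_pow, pderiv_X_self, mul_one,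
    pderiv_eq_zero_of_notMem_vars (last_notMem_vars_rename_castSucc g), sub_zero, map_mul, map_natCast,
    map_pow, MvPolynomial.eval_X, Fin.snoc_last]

/-- `∂F/∂xᵢ (x,t) = −∂g/∂xᵢ (x)` (`i < 3`). [folklore] -/
private theorem eval_snoc_pderiv_castSucc (g : MvPolynomial (Fin 3) ℂ) (x : Fin 3 → ℂ) (t : ℂ) (i : Fin 3) :
    MvPolynomial.eval (Fin.snoc x t : Fin 4 → ℂ) (pderiv (Fin.castSucc i) (cyclicCoverForm p g)) =
      -MvPolynomial.eval x (pderiv i g) := by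
  rw [cyclicCoverForm_def, map_sub, pderiv_pow, pderiv_X_of_ne (Fin.castSucc_lt_last i).ne', mul_zero,
    zero_sub, map_neg, pderiv_rename (Fin.castSucc_injective 3), eval_rename, snoc_comp_castSucc]

/-- `∂(c·g)/∂xᵢ (x) = c · ∂g/∂xᵢ (x)`. [folklore] -/
private theorem eval_pderiv_smul (g : MvPolynomial (Fin 3) ℂ) (c : ℂ) (i : Fin 3) (x : Fin 3 → ℂ) :
    MvPolynomial.eval x (pderiv i (c • g)) = c * MvPolynomial.eval x (pderiv i g) := by
  rw [MvPolynomial.smul_eq_C_mul, Derivation.leibniz, pderiv_C, smul_zero, add_zero, smul_eq_mul, map_mul,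
    MvPolynomial.eval_C]

/-- Euler: a homogeneous form of positive degree vanishes where all its partials vanish. [folklore] -/
private theorem eval_eq_zero_of_forall_eval_pderiv_eq_zero {g : MvPolynomial (Fin 3) ℂ} (hg : g.IsHomogeneous p)
    (hp : p ≠ 0) (x : Fin 3 → ℂ) (hx : ∀ j, MvPolynomial.eval x (pderiv j g) = 0) : MvPolynomial.eval x g = 0 := by
  have h := congrArg (MvPolynomial.eval x) hg.sum_X_mul_pderiv
  rw [map_sum, map_nsmul, Finset.sum_eq_zero fun j _ ↦ by rw [map_mul, hx j, mul_zero],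
    nsmul_eq_mul] at h
  rcases mul_eq_zero.1 h.symm with h1 | h1
  · exact absurd h1 (Nat.cast_ne_zero.2 hp)
  · exact h1

/-- **The cyclic cover form `x₃^p − c·g` (`c ≠ 0`, `p ≥ 2`, `g` a ternary `p`-form) is nonsingular iff the
gradient of `g` has no non-trivial zero** (i.e. iff the branch curve `V(g)` is smooth; Carlson–Toledo §2:
"`Ũ = ℂ^{N+1} − Δ̃`, where `Δ̃` is the pre-image of `Δ`"). Gradient criterion: at a zero of
`F = x₃^p − c g` with `∇F = 0` one has `p x₃^{p−1} = 0`, so `x₃ = 0` and `∇g(x) = 0`; conversely a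
non-trivial zero of `∇g` is (by Euler) a zero of `g`, and `(x, 0)` is a singular point of `F`.
[cite: CarlsonToledo1999, §2 (held text p0004)] -/
theorem isNonsingularForm_cyclicCoverForm_smul_iff (hp : 2 ≤ p) {g : MvPolynomial (Fin 3) ℂ}
    (hg : g.IsHomogeneous p) {c : ℂ} (hc : c ≠ 0) :
    SmoothHypersurface.IsNonsingularForm ℂ (cyclicCoverForm p (c • g)) ↔
      ∀ x : Fin 3 → ℂ, x ≠ 0 → ∃ i, MvPolynomial.eval x (pderiv i g) ≠ 0 := by
  have hcg : (c • g).IsHomogeneous p := by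
    rw [MvPolynomial.smul_eq_C_mul]
    simpa using (MvPolynomial.isHomogeneous_C (Fin 3) c).mul hg
  rw [SmoothHypersurface.isNonsingularForm_iff_forall_exists_eval_pderiv_ne_zero]
  constructor
  · intro h x hx
    by_contra hcon
    push Not at hcon
    have hgx : MvPolynomial.eval x g = 0 := eval_eq_zero_of_forall_eval_pderiv_eq_zero hg (by omega) x hcon
    obtain ⟨j, hj⟩ := h (Fin.snoc x 0) (snoc_ne_zero hx 0) (by
      rw [eval_snoc_cyclicCoverForm, zero_pow (by omega), MvPolynomial.smul_eval, hgx, mul_zero, sub_zero])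
    apply hj
    induction j using Fin.lastCases with
    | last => rw [eval_snoc_pderiv_last, zero_pow (by omega), mul_zero]
    | cast i => rw [eval_snoc_pderiv_castSucc, eval_pderiv_smul, hcon i, mul_zero, neg_zero]
  · intro h z hz hFz
    -- write `z = (x, t)`
    obtain ⟨x, t, rfl⟩ : ∃ (x : Fin 3 → ℂ) (t : ℂ), z = Fin.snoc x t := ⟨Fin.init z, z (Fin.last 3), (Fin.snoc_init_self z).symm⟩
    by_cases ht : t = 0
    · subst ht
      have hx : x ≠ 0 := by
        rintro rfl
        exact hz (funext fun j => by
          induction j using Fin.lastCases with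
          | last => exact Fin.snoc_last (α := fun _ => ℂ) (x := (0 : ℂ)) (p := (0 : Fin 3 → ℂ))
          | cast i => simp)
      obtain ⟨i, hi⟩ := h x hx
      refine ⟨Fin.castSucc i, ?_⟩
      rw [eval_snoc_pderiv_castSucc, eval_pderiv_smul, neg_ne_zero]
      exact mul_ne_zero hc hi
    · refine ⟨Fin.last 3, ?_⟩
      rw [eval_snoc_pderiv_last]
      exact mul_ne_zero (Nat.cast_ne_zero.2 (by omega)) (pow_ne_zero _ ht)

/-- **Scaling the branch form preserves nonsingularity**: for `c ≠ 0`, `x₃^p − c·g` is a nonsingular form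
iff `x₃^p − g` is (both say that `V(g)` is a smooth curve). [cite: CarlsonToledo1999, §2 (held text p0004)] -/
theorem isNonsingularForm_cyclicCoverForm_smul (hp : 2 ≤ p) {g : MvPolynomial (Fin 3) ℂ}
    (hg : g.IsHomogeneous p) {c : ℂ} (hc : c ≠ 0)
    (hJ : SmoothHypersurface.IsNonsingularForm ℂ (cyclicCoverForm p g)) :
    SmoothHypersurface.IsNonsingularForm ℂ (cyclicCoverForm p (c • g)) := by
  rw [isNonsingularForm_cyclicCoverForm_smul_iff hp hg hc]
  rw [← one_smul ℂ g, isNonsingularForm_cyclicCoverForm_smul_iff hp hg one_ne_zero] at hJ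
  exact hJ

end Nonsingular

/-! ### §2 The scaling specialisation `a ↦ x₃^p − λ f` and its family -/

section Family

variable (p : ℕ) (f : MvPolynomial (Fin 3) ℂ)

/-- `b_e ↦ f_e · λ`: the comorphism of the line `λ ↦ λ·(f_e)_e` through the coefficient vector of `f`.
[cite: CarlsonToledo1999, §2 (held text p0004)] -/
def scaleHom : MvPolynomial (TernaryIndex p) ℂ →ₐ[ℂ] MvPolynomial Unit ℂ :=
  MvPolynomial.aeval fun e : TernaryIndex p => MvPolynomial.C (f.coeff e.1) * MvPolynomial.X ()

/-- **The scaling specialisation** `ℂ[a_m] → ℂ[λ]`, `a_{x₃^p} ↦ 1`, `a_{(e,0)} ↦ −f_e λ`, other `a_m ↦ 0`: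
the universal quaternary `p`-form specialises to `x₃^p − λ f`. [cite: CarlsonToledo1999, §2 (held text p0004)] -/
def scalingSpz : CoeffRing ℂ 2 p →ₐ[ℂ] MvPolynomial Unit ℂ := (scaleHom p f).comp (cyclicCoverSpz p)

/-- Evaluation `λ ↦ c`. [folklore] -/
def evalAt (c : ℂ) : MvPolynomial Unit ℂ →ₐ[ℂ] ℂ := MvPolynomial.aeval fun _ => c

/-- `evalAt c (λ) = c`. [cite: CarlsonToledo1999, §2 (held text p0004)] -/
@[simp] theorem evalAt_X (c : ℂ) : evalAt c (MvPolynomial.X ()) = c := MvPolynomial.aeval_X _ _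

/-- `evalAt c` fixes constants. [cite: CarlsonToledo1999, §2 (held text p0004)] -/
@[simp] theorem evalAt_C (c r : ℂ) : evalAt c (MvPolynomial.C r) = r := by simp [evalAt]

/-- `(λ ↦ c) ∘ (b_e ↦ f_e λ) = ψ_{c f}`. [cite: CarlsonToledo1999, §2 (held text p0004)] -/
theorem evalAt_comp_scaleHom (c : ℂ) : (evalAt c).comp (scaleHom p f) = ternaryCoeffHom p (c • f) := by
  refine MvPolynomial.algHom_ext fun e => ?_
  rw [AlgHom.comp_apply, scaleHom, MvPolynomial.aeval_X, map_mul, evalAt_C, evalAt_X, ternaryCoeffHom_X,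
    MvPolynomial.coeff_smul, smul_eq_mul, mul_comm]

/-- **`x₃^p − c f` is the form of the parameter `λ = c` of the scaling family**: `(λ ↦ c) ∘ scalingSpz = coeffHom (x₃^p − c f)`.
[cite: CarlsonToledo1999, §2 (held text p0004)] -/
theorem evalAt_comp_scalingSpz (hp : p ≠ 0) (c : ℂ) :
    (evalAt c).comp (scalingSpz p f) = coeffHom ℂ 2 p (cyclicCoverForm p (c • f)) := by
  rw [scalingSpz, ← AlgHom.comp_assoc, evalAt_comp_scaleHom, ternaryCoeffHom_comp_cyclicCoverSpz p hp]

/-- `scalingSpz (a_{(e,0)}) = −f_e λ`. [cite: CarlsonToledo1999, §2 (held text p0004)] -/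
theorem scalingSpz_X_extendIndex (hp : p ≠ 0) (e : TernaryIndex p) :
    scalingSpz p f (MvPolynomial.X (extendIndex e)) = -(MvPolynomial.C (f.coeff e.1) * MvPolynomial.X ()) := by
  rw [scalingSpz, AlgHom.comp_apply, cyclicCoverSpz_X_extendIndex p hp, map_neg, scaleHom, MvPolynomial.aeval_X]

/-- **The scaling specialisation is surjective** for a non-zero `p`-form `f` (`λ = −scalingSpz(a_{(e,0)})/f_e` for a
non-zero coefficient `f_e`), so that `S_λ → U` is a closed immersion into an open of `U`.
[cite: CarlsonToledo1999, §2 (held text p0004)] -/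
theorem scalingSpz_surjective (hp : p ≠ 0) (hf : f.IsHomogeneous p) (hf0 : f ≠ 0) :
    Function.Surjective (scalingSpz p f) := by
  obtain ⟨m, hm⟩ := MvPolynomial.ne_zero_iff.mp hf0
  have hdeg : m.degree = p := by
    have h := hf hm
    rw [Finsupp.degree_eq_weight_one]
    exact h
  set e : TernaryIndex p := ⟨m, hdeg⟩
  rw [← AlgHom.range_eq_top, eq_top_iff, ← MvPolynomial.adjoin_range_X, Algebra.adjoin_le_iff]
  rintro _ ⟨u, rfl⟩
  refine ⟨MvPolynomial.C (-(f.coeff m)⁻¹) * MvPolynomial.X (extendIndex e), ?_⟩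
  change scalingSpz p f (MvPolynomial.C (-(f.coeff m)⁻¹) * MvPolynomial.X (extendIndex e)) = MvPolynomial.X u
  rw [map_mul, MvPolynomial.algHom_C, scalingSpz_X_extendIndex p f hp e, MvPolynomial.algebraMap_eq]
  change MvPolynomial.C (-(f.coeff m)⁻¹) * -(MvPolynomial.C (f.coeff m) * MvPolynomial.X ()) = MvPolynomial.X u
  rw [mul_neg, ← mul_assoc, ← map_mul, neg_mul, inv_mul_cancel₀ hm, map_neg, map_one, neg_mul, one_mul, neg_neg]

/-- The base `S_λ ⊆ 𝔸¹` of the scaling family: the `λ` with `x₃^p − λ f` nonsingular. [cite: CarlsonToledo1999, §2 (held text p0004)] -/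
abbrev scalingBase : SchemeOver ℂ := baseSpz ℂ 2 p (scalingSpz p f)

/-- The total space of the scaling family. [cite: CarlsonToledo1999, §2 (held text p0004)] -/
abbrev scalingTotal : SchemeOver ℂ := totalSpz ℂ 2 p (scalingSpz p f)

/-- **The scaling family** `λ ↦ X_{x₃^p − λ f}` (the universal quaternary `p`-ic pulled back along `S_λ → U`).
[cite: CarlsonToledo1999, §2 (held text p0004)] -/
abbrev scalingFamily : scalingTotal p f ⟶ scalingBase p f := familySpz ℂ 2 p (scalingSpz p f)

/-- `R² u_* ℚ` of the scaling family is a local system (Ehresmann). [cite: VoisinHodgeI2002, Thm. 9.3 and §9.2.1] -/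
theorem scalingFamily_locallyTrivial [NeZero p] :
    IsCohomologicallyLocallyTrivialOn (scalingFamily p f) (Set.univ : Set (ComplexPoints (scalingBase p f))) :=
  isCohomologicallyLocallyTrivialOn_familySpz 2 p _ (by norm_num) NeZero.one_le

variable {p f}

/-- `c • f` is homogeneous of degree `p`. [cite: CarlsonToledo1999, §2 (held text p0004)] -/
theorem isHomogeneous_smul (hf : f.IsHomogeneous p) (c : ℂ) : (c • f).IsHomogeneous p := by
  rw [MvPolynomial.smul_eq_C_mul]
  simpa using (MvPolynomial.isHomogeneous_C (Fin 3) c).mul hf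

variable (p f) in
/-- **The point `λ = c` of the scaling family** (`c ≠ 0`, `x₃^p − f` nonsingular). [cite: CarlsonToledo1999, §2 (held text p0004)] -/
def scalingPoint (hp : 2 ≤ p) (hf : f.IsHomogeneous p)
    (hJ : SmoothHypersurface.IsNonsingularForm ℂ (cyclicCoverForm p f)) (c : ℂ) (hc : c ≠ 0) :
    ComplexPoints (scalingBase p f) :=
  pointOfFormSpz ℂ 2 p (scalingSpz p f)
    (CyclicCoverFormNonsingular.isHomogeneous_cyclicCoverForm_of_isHomogeneous (isHomogeneous_smul hf c))
    (isNonsingularForm_cyclicCoverForm_smul hp hf hc hJ) (evalAt_comp_scalingSpz p f (by omega) c)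

/-- The image of `λ = c` in `U(ℂ)` is the point `[x₃^p − c f]`. [cite: CarlsonToledo1999, §2 (held text p0004)] -/
theorem map_toBaseSpz_scalingPoint (hp : 2 ≤ p) (hf : f.IsHomogeneous p)
    (hJ : SmoothHypersurface.IsNonsingularForm ℂ (cyclicCoverForm p f)) (c : ℂ) (hc : c ≠ 0) :
    AlgPoints.map (toBaseSpz ℂ 2 p (scalingSpz p f)) (scalingPoint p f hp hf hJ c hc) =
      pointOfForm ℂ 2 p
        (CyclicCoverFormNonsingular.isHomogeneous_cyclicCoverForm_of_isHomogeneous (isHomogeneous_smul hf c))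
        (isNonsingularForm_cyclicCoverForm_smul hp hf hc hJ) :=
  map_toBaseSpz_pointOfFormSpz ℂ 2 p _ _ _ _

/-- The image of the Carlson–Toledo point `[x₃^p − c f]` in `U(ℂ)` is the same point. [cite: CarlsonToledo1999, §2 (held text p0004)] -/
theorem map_toBaseSpz_cyclicCoverPoint_smul [NeZero p] (hp : 2 ≤ p) (hf : f.IsHomogeneous p)
    (hJ : SmoothHypersurface.IsNonsingularForm ℂ (cyclicCoverForm p f)) (c : ℂ) (hc : c ≠ 0) :
    AlgPoints.map (toBaseSpz ℂ 2 p (cyclicCoverSpz p)) (cyclicCoverPoint p (c • f)) =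
      pointOfForm ℂ 2 p
        (CyclicCoverFormNonsingular.isHomogeneous_cyclicCoverForm_of_isHomogeneous (isHomogeneous_smul hf c))
        (isNonsingularForm_cyclicCoverForm_smul hp hf hc hJ) := by
  rw [cyclicCoverPoint_eq p (isHomogeneous_smul hf c) (isNonsingularForm_cyclicCoverForm_smul hp hf hc hJ)]
  exact map_toBaseSpz_pointOfFormSpz ℂ 2 p _ _ _ _

end Family

/-! ### §3 Continuity of families of points; the scaling arcs -/

section Arcs

/-- **Points of a specialised base along a surjective specialisation embed into `U(ℂ)`** (`S_φ → U` is then a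
closed immersion into an open of `U`; Serre, GAGA §2 n°5 Lemme 1 b). [cite: SerreGAGA1956, §2 n°5] -/
theorem isEmbedding_map_toBaseSpz {n d : ℕ} {ι : Type} (φ : CoeffRing ℂ n d →ₐ[ℂ] MvPolynomial ι ℂ)
    (hφ : Function.Surjective φ) :
    IsEmbedding (AlgPoints.map (toBaseSpz ℂ n d φ) :
      ComplexPoints (baseSpz ℂ n d φ) → ComplexPoints (base ℂ n d)) := by
  haveI := isClosedImmersion_toBaseSpz_left ℂ n d φ hφ
  exact AlgPoints.isEmbedding_map_of_isClosedImmersion (toBaseSpz ℂ n d φ)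

/-- A family of points of `S_φ(ℂ)` is continuous as soon as its image in `U(ℂ)` is (`φ` surjective).
[cite: SerreGAGA1956, §2 n°5] -/
theorem continuous_of_map_toBaseSpz {n d : ℕ} {ι : Type} (φ : CoeffRing ℂ n d →ₐ[ℂ] MvPolynomial ι ℂ)
    (hφ : Function.Surjective φ) {X : Type*} [TopologicalSpace X] {g : X → ComplexPoints (baseSpz ℂ n d φ)}
    (hg : Continuous fun x => AlgPoints.map (toBaseSpz ℂ n d φ) (g x)) : Continuous g :=
  (isEmbedding_map_toBaseSpz φ hφ).continuous_iff.mpr hg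

variable {p : ℕ} {f : MvPolynomial (Fin 3) ℂ}

/-- **A continuous family `c(x) ≠ 0` of scalings gives a continuous family of points `[x₃^p − c(x) f]` of
`U(ℂ)`** (through the coefficient chart of `U(ℂ)`). [cite: VoisinHodgeII2003, §6.2.1] [cite: SerreGAGA1956, §2 n°5] -/
theorem continuous_pointOfForm_smul (hp : 2 ≤ p) (hf : f.IsHomogeneous p)
    (hJ : SmoothHypersurface.IsNonsingularForm ℂ (cyclicCoverForm p f)) {X : Type*} [TopologicalSpace X]
    {c : X → ℂ} (hc : Continuous c) (hc0 : ∀ x, c x ≠ 0) :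
    Continuous fun x => pointOfForm ℂ 2 p
      (CyclicCoverFormNonsingular.isHomogeneous_cyclicCoverForm_of_isHomogeneous (isHomogeneous_smul hf (c x)))
      (isNonsingularForm_cyclicCoverForm_smul hp hf (hc0 x) hJ) := by
  -- the coefficient vectors
  let a : X → DegIndex 2 p → ℂ := fun x m => MvPolynomial.coeff m.1 (cyclicCoverForm p (c x • f))
  have hform : ∀ x, formOfCoeffs (a x) = cyclicCoverForm p (c x • f) := fun x =>
    formOfCoeffs_coeff _ (CyclicCoverFormNonsingular.isHomogeneous_cyclicCoverForm_of_isHomogeneous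
      (isHomogeneous_smul hf (c x)))
  have hJ' : ∀ x, SmoothHypersurface.IsNonsingularForm ℂ (formOfCoeffs (a x)) := fun x => by
    rw [hform]; exact isNonsingularForm_cyclicCoverForm_smul hp hf (hc0 x) hJ
  have ha : Continuous a := by
    refine continuous_pi fun m => ?_
    have : (fun x => a x m) = fun x =>
        (if m.1 = Finsupp.single (Fin.last 3) p then (1 : ℂ) else 0) -
          (if m.1 (Fin.last 3) = 0 then c x * f.coeff (restrictExp m.1) else 0) := by
      funext x
      simp only [a]
      rw [coeff_cyclicCoverForm p, MvPolynomial.coeff_smul, smul_eq_mul]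
    rw [this]
    refine continuous_const.sub ?_
    split_ifs
    · exact hc.mul continuous_const
    · exact continuous_const
  have hcont := continuous_pointOfCoeffs_comp ℂ 2 p ha hJ'
  convert hcont using 1
  funext x
  apply pointForm_injective ℂ 2 p
  rw [pointForm_pointOfForm, pointForm_pointOfCoeffs, hform]

/-- The half-turn parameters `c_θ₀(u) = e^{πi(θ₀+u)}` (`θ₀ = 0`: from `1` to `−1` through `i`; `θ₀ = 1`: from `−1`
to `1` through `−i`). [cite: VoisinHodgeII2003, §3.2.1] -/
def halfTurn (θ₀ : ℝ) (u : unitInterval) : ℂ :=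
  Complex.exp ((Real.pi : ℂ) * Complex.I * ((θ₀ : ℂ) + ((u : ℝ) : ℂ)))

/-- `c_θ₀` is continuous. [cite: VoisinHodgeII2003, §3.2.1] -/
theorem continuous_halfTurn (θ₀ : ℝ) : Continuous (halfTurn θ₀) :=
  Complex.continuous_exp.comp (continuous_const.mul (continuous_const.add
    (Complex.continuous_ofReal.comp continuous_subtype_val)))

/-- `c_θ₀(u) ≠ 0`. [cite: VoisinHodgeII2003, §3.2.1] -/
theorem halfTurn_ne_zero (θ₀ : ℝ) (u : unitInterval) : halfTurn θ₀ u ≠ 0 := Complex.exp_ne_zero _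

/-- **The scaling arc in `S_λ(ℂ)`**: `u ↦ (λ = c_θ₀(u))`. [cite: CarlsonToledo1999, §2 (held text p0004)] -/
def scalingArc (hp : 2 ≤ p) (hf : f.IsHomogeneous p) (hf0 : f ≠ 0)
    (hJ : SmoothHypersurface.IsNonsingularForm ℂ (cyclicCoverForm p f)) (θ₀ : ℝ) :
    Path (scalingPoint p f hp hf hJ (halfTurn θ₀ 0) (halfTurn_ne_zero θ₀ 0))
      (scalingPoint p f hp hf hJ (halfTurn θ₀ 1) (halfTurn_ne_zero θ₀ 1)) where
  toFun u := scalingPoint p f hp hf hJ (halfTurn θ₀ u) (halfTurn_ne_zero θ₀ u)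
  continuous_toFun := by
    refine continuous_of_map_toBaseSpz (scalingSpz p f) (scalingSpz_surjective p f (by omega) hf hf0) ?_
    have h : (fun u : unitInterval => AlgPoints.map (toBaseSpz ℂ 2 p (scalingSpz p f))
        (scalingPoint p f hp hf hJ (halfTurn θ₀ u) (halfTurn_ne_zero θ₀ u))) = fun u => pointOfForm ℂ 2 p
        (CyclicCoverFormNonsingular.isHomogeneous_cyclicCoverForm_of_isHomogeneous (isHomogeneous_smul hf (halfTurn θ₀ u)))
        (isNonsingularForm_cyclicCoverForm_smul hp hf (halfTurn_ne_zero θ₀ u) hJ) :=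
      funext fun u => map_toBaseSpz_scalingPoint hp hf hJ _ (halfTurn_ne_zero θ₀ u)
    rw [h]
    exact continuous_pointOfForm_smul hp hf hJ (continuous_halfTurn θ₀) (halfTurn_ne_zero θ₀)
  source' := rfl
  target' := rfl

/-- The scaling arc, pointwise. [cite: CarlsonToledo1999, §2 (held text p0004)] -/
theorem scalingArc_apply (hp : 2 ≤ p) (hf : f.IsHomogeneous p) (hf0 : f ≠ 0)
    (hJ : SmoothHypersurface.IsNonsingularForm ℂ (cyclicCoverForm p f)) (θ₀ : ℝ) (u : unitInterval) :
    scalingArc hp hf hf0 hJ θ₀ u = scalingPoint p f hp hf hJ (halfTurn θ₀ u) (halfTurn_ne_zero θ₀ u) := rfl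

/-- **The same arc in the Carlson–Toledo base `S(ℂ)`**: `u ↦ [x₃^p − c_θ₀(u) f]`. [cite: CarlsonToledo1999, §2 (held text p0004)] -/
def cyclicCoverArc [NeZero p] (hp : 2 ≤ p) (hf : f.IsHomogeneous p)
    (hJ : SmoothHypersurface.IsNonsingularForm ℂ (cyclicCoverForm p f)) (θ₀ : ℝ) :
    Path (cyclicCoverPoint p (halfTurn θ₀ 0 • f)) (cyclicCoverPoint p (halfTurn θ₀ 1 • f)) where
  toFun u := cyclicCoverPoint p (halfTurn θ₀ u • f)
  continuous_toFun := by
    refine continuous_of_map_toBaseSpz (cyclicCoverSpz p) (cyclicCoverSpz_surjective p (NeZero.ne p)) ?_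
    have h : (fun u : unitInterval => AlgPoints.map (toBaseSpz ℂ 2 p (cyclicCoverSpz p))
        (cyclicCoverPoint p (halfTurn θ₀ u • f))) = fun u => pointOfForm ℂ 2 p
        (CyclicCoverFormNonsingular.isHomogeneous_cyclicCoverForm_of_isHomogeneous (isHomogeneous_smul hf (halfTurn θ₀ u)))
        (isNonsingularForm_cyclicCoverForm_smul hp hf (halfTurn_ne_zero θ₀ u) hJ) :=
      funext fun u => map_toBaseSpz_cyclicCoverPoint_smul hp hf hJ _ (halfTurn_ne_zero θ₀ u)
    rw [h]
    exact continuous_pointOfForm_smul hp hf hJ (continuous_halfTurn θ₀) (halfTurn_ne_zero θ₀)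
  source' := rfl
  target' := rfl

/-- The Carlson–Toledo arc, pointwise. [cite: CarlsonToledo1999, §2 (held text p0004)] -/
theorem cyclicCoverArc_apply [NeZero p] (hp : 2 ≤ p) (hf : f.IsHomogeneous p)
    (hJ : SmoothHypersurface.IsNonsingularForm ℂ (cyclicCoverForm p f)) (θ₀ : ℝ) (u : unitInterval) :
    cyclicCoverArc hp hf hJ θ₀ u = cyclicCoverPoint p (halfTurn θ₀ u • f) := rfl

/-- **The common image arc in `U(ℂ)`**: `u ↦ [x₃^p − c_θ₀(u) f]`. [cite: VoisinHodgeII2003, §6.2.1] -/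
def universalArc (hp : 2 ≤ p) (hf : f.IsHomogeneous p)
    (hJ : SmoothHypersurface.IsNonsingularForm ℂ (cyclicCoverForm p f)) (θ₀ : ℝ) :
    Path (pointOfForm ℂ 2 p
        (CyclicCoverFormNonsingular.isHomogeneous_cyclicCoverForm_of_isHomogeneous (isHomogeneous_smul hf (halfTurn θ₀ 0)))
        (isNonsingularForm_cyclicCoverForm_smul hp hf (halfTurn_ne_zero θ₀ 0) hJ))
      (pointOfForm ℂ 2 p
        (CyclicCoverFormNonsingular.isHomogeneous_cyclicCoverForm_of_isHomogeneous (isHomogeneous_smul hf (halfTurn θ₀ 1)))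
        (isNonsingularForm_cyclicCoverForm_smul hp hf (halfTurn_ne_zero θ₀ 1) hJ)) where
  toFun u := pointOfForm ℂ 2 p
    (CyclicCoverFormNonsingular.isHomogeneous_cyclicCoverForm_of_isHomogeneous (isHomogeneous_smul hf (halfTurn θ₀ u)))
    (isNonsingularForm_cyclicCoverForm_smul hp hf (halfTurn_ne_zero θ₀ u) hJ)
  continuous_toFun := continuous_pointOfForm_smul hp hf hJ (continuous_halfTurn θ₀) (halfTurn_ne_zero θ₀)
  source' := rfl
  target' := rfl

/-- The scaling arc lies over the universal arc. [cite: VoisinHodgeII2003, §6.2.1] -/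
theorem map_toBaseSpz_scalingArc (hp : 2 ≤ p) (hf : f.IsHomogeneous p) (hf0 : f ≠ 0)
    (hJ : SmoothHypersurface.IsNonsingularForm ℂ (cyclicCoverForm p f)) (θ₀ : ℝ) (u : unitInterval) :
    AlgPoints.map (toBaseSpz ℂ 2 p (scalingSpz p f)) (scalingArc hp hf hf0 hJ θ₀ u) = universalArc hp hf hJ θ₀ u :=
  map_toBaseSpz_scalingPoint hp hf hJ _ (halfTurn_ne_zero θ₀ u)

/-- The Carlson–Toledo arc lies over the universal arc. [cite: VoisinHodgeII2003, §6.2.1] -/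
theorem map_toBaseSpz_cyclicCoverArc [NeZero p] (hp : 2 ≤ p) (hf : f.IsHomogeneous p)
    (hJ : SmoothHypersurface.IsNonsingularForm ℂ (cyclicCoverForm p f)) (θ₀ : ℝ) (u : unitInterval) :
    AlgPoints.map (toBaseSpz ℂ 2 p (cyclicCoverSpz p)) (cyclicCoverArc hp hf hJ θ₀ u) = universalArc hp hf hJ θ₀ u :=
  map_toBaseSpz_cyclicCoverPoint_smul hp hf hJ _ (halfTurn_ne_zero θ₀ u)

/-- `c₀(0) = 1`. [cite: VoisinHodgeII2003, §3.2.1] -/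
@[simp] theorem halfTurn_zero_zero : halfTurn 0 0 = 1 := by simp [halfTurn]

/-- `c₁(1) = 1` (`e^{2πi} = 1`). [cite: VoisinHodgeII2003, §3.2.1] -/
@[simp] theorem halfTurn_one_one : halfTurn 1 1 = 1 := by
  have h1 : (((1 : unitInterval) : ℝ) : ℂ) = 1 := by simp
  rw [halfTurn, h1, Complex.ofReal_one]
  have : (Real.pi : ℂ) * Complex.I * (1 + 1) = 2 * Real.pi * Complex.I := by ring
  rw [this, Complex.exp_two_pi_mul_I]

/-- `c₀(1) = c₁(0)` (`= −1`). [cite: VoisinHodgeII2003, §3.2.1] -/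
theorem halfTurn_zero_one : halfTurn 0 1 = halfTurn 1 0 := by
  simp [halfTurn]

end Arcs

end CyclicCoverScaling

end Literature.AlgebraicGeometry.HodgeTheory

end
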